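import Literature.AlgebraicGeometry.Motives.FamiliesVHSExteriorPower
import Literature.AlgebraicGeometry.Motives.HodgeStructureTensorPolarization
import Literature.AlgebraicGeometry.Motives.HodgeStructureDeligneTorusTensor
import Literature.AlgebraicGeometry.Motives.HodgeTensorFactsHolds
import Literature.AlgebraicGeometry.Motives.FamiliesVHSComap
import Mathlib.LinearAlgebra.TensorProduct.Tower
import Mathlib.LinearAlgebra.TensorProduct.Basis
import Mathlib.Algebra.Category.ModuleCat.ChangeOfRings
import HarnessLib

/-!
# The tensor product `D₁ ⊗ D₂` of the data of two polarized variations of Hodge structure: the local systems `V₁,ℤ ⊗ V₂,ℤ`, `V₁ ⊗ V₂`,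
# the comparison `(V₁,ℤ ⊗ V₂,ℤ) ⊗ ℚ ≅ V₁ ⊗ V₂`, the fibrewise tensor Hodge structures and the product polarization

Topic `Literature/AlgebraicGeometry/Motives` (namespaces `Literature.AlgebraicGeometry.Motives.LocalSystem`, `….Motives.VHSData`), lane `lit-hodgefound`
(seat `p08`, row g56-#7).  DEFINITIONS WITH BODIES (`LocalSystem.tensor`, the comparison `VHSData.tensorRatIsoApp` ∕ `tensorRatIso`,
`VHSData.tensor`) and their API; no named fact, no instance, no notation (D-0026 net debt `0`).  Companion of `Motives/FamiliesVHSExteriorPower`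
(the exterior-power variation `⋀ᵈ D`), whose comparison pattern (`ratInv`, `map_hom_toRat`, `finite_fiber`) is reused.

PRINTED SOURCES.  P. Deligne, *Équations différentielles à points singuliers réguliers*, LNM 163 (1970), I.1: local systems form a `⊗`-category, the
tensor operations being performed fibrewise (functors on the fundamental groupoid).  P. Griffiths, *Periods of integrals on algebraic manifolds III*,
Publ. Math. IHÉS 38 (1970), §1 ∕ W. Schmid, *Variation of Hodge structure*, Invent. Math. 22 (1973), §2: variations of Hodge structure are stable under
the tensor constructions of linear algebra (`𝒱₁ ⊗ 𝒱₂`, duals, `Hom`), the Hodge filtration of `𝒱₁ ⊗ 𝒱₂` being `F^p = Σ_{a+b=p} F^a ⊗ F^b` and the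
polarization the product form.  P. Deligne, *Théorie de Hodge II*, 1.1.12, 2.1.15 (tensor product of Hodge structures, weights add; polarizations);
B. Moonen, *Families of motives and the Mumford–Tate conjecture*, §2.1 («`HS^pol` is closed under tensor products»).  E. Cattani, P. Deligne,
A. Kaplan, *On the locus of Hodge classes*, J. AMS 8 (1995), §1 (the locus of Hodge classes of a polarized `ℤ`VHS — applied in the later literature
to the TENSOR variations `𝕍^⊗`: the «tensorial Hodge locus `HL(S, 𝕍^⊗)`», Klingler–Otwinowska–Urbanik §1.1, Bakker–Klingler–Tsimerman Thm. 1.6).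

* §1 **`LocalSystem.tensor V₁ V₂`** — the tensor product of local systems of `R`-modules (`R` commutative): fibre `V₁,x ⊗_R V₂,x`, transport
  `γ ↦ γ_* ⊗ γ_*` (Mathlib `TensorProduct.map`); `rfl` API (`tensor_fiber`, `tensor_transport`, `tensor_transport_tmul`, `tensor_comap`).
* §2 **the comparison `(V₁,ℤ ⊗_ℤ V₂,ℤ) ⊗ ℚ ⥲ V₁ ⊗_ℚ V₂`** for two VHS data `D₁`, `D₂` on `S`: `tensorRatIsoApp` = Mathlib's
  `TensorProduct.AlgebraTensorModule.distribBaseChange` (`ℚ ⊗ (M₁ ⊗_ℤ M₂) ≃ (ℚ ⊗ M₁) ⊗_ℚ (ℚ ⊗ M₂)`) followed by `ratIso₁⁻¹ ⊗ ratIso₂⁻¹`;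
  `1 ⊗ (m₁ ⊗ m₂) ↦ toRat m₁ ⊗ toRat m₂`; naturality along `Π₁(S)` (`tensorRatIsoApp_naturality`); the natural isomorphism `tensorRatIso`.
* §3 **`VHSData.tensor D₁ D₂ : VHSData S (k₁ + k₂)`** — integral and rational local systems `V₁,ℤ ⊗ V₂,ℤ`, `V₁ ⊗ V₂`, the comparison of §2, on each
  fibre the tensor Hodge structure `(V₁,s, F) ⊗ (V₂,s, F)` of weight `k₁ + k₂` (the tree's `HodgeStructure.tensor`, its separation ∕ opposedness
  facts discharged by `hodgeTensorFacts_holds`) polarized by the PRODUCT FORM `Q₁ ⊗ Q₂` (the tree's `Polarization.tensor`), which is flat because both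
  transports are isometries; integral fibres finitely generated free.
* §4 API: `tensor_toRat_tmul` (`toRat(m₁ ⊗ m₂) = toRat m₁ ⊗ toRat m₂`), `tensor_form_form_tmul`, **`isHodgeAt_tensor_tmul`** (an integral pure tensor
  of Hodge classes of levels `p₁`, `p₂` is a Hodge class of level `p₁ + p₂`), `isHodgeAt_tensor_transport_tmul`.

HONEST SCOPE: as for every `VHSData`, holomorphy and transversality are not recorded; the Hodge-theoretic input (the tensor product of Hodge structures is
a Hodge structure, the product form polarizes it) is the tree's (`Motives/HodgeTensor`, `Motives/HodgeStructureTensorPolarization`).  Duals, `Hom` and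
tensor powers of VHS data are not in this file.

## References

* [Deligne1970] P. Deligne, *Équations différentielles à points singuliers réguliers*, LNM 163 (1970), I.1.
* [Griffiths1970] P. Griffiths, *Periods of integrals on algebraic manifolds III*, Publ. Math. IHÉS 38 (1970), §1.
* [Schmid1973] W. Schmid, *Variation of Hodge structure: the singularities of the period mapping*, Invent. Math. 22 (1973), §2.
* [DeligneHodgeII1971] P. Deligne, *Théorie de Hodge II*, Publ. Math. IHÉS 40 (1971), 1.1.12, 2.1.15.
* [Moonen2017FamiliesMotives] B. Moonen, *Families of motives and the Mumford–Tate conjecture*, Milan J. Math. 85 (2017), §2.1.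
* [CattaniDeligneKaplan1995] E. Cattani, P. Deligne, A. Kaplan, *On the locus of Hodge classes*, J. Amer. Math. Soc. 8 (1995), §1.
* [KlinglerOtwinowskaUrbanik2023] B. Klingler, A. Otwinowska, D. Urbanik, *On the fields of definition of Hodge loci*, Ann. Sci. ÉNS 56 (2023), §1.1.
* [BakkerKlinglerTsimerman2020] B. Bakker, B. Klingler, J. Tsimerman, *Tame topology of arithmetic quotients and algebraicity of Hodge loci*, J. AMS 33
  (2020), Thm. 1.6.
-/

noncomputable section

open CategoryTheory
open scoped TensorProduct ChangeOfRings

universe u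

namespace Literature.AlgebraicGeometry.Motives

/-! ## §1 The tensor product of local systems -/

namespace LocalSystem

variable {R : Type u} [CommRing R] {S : Type u} [TopologicalSpace S]

/-- **The tensor product `V₁ ⊗ V₂` of local systems** of `R`-modules (`R` commutative): the functor `Π₁(S) ⥤ Mod_R` with value `V₁,x ⊗_R V₂,x` and
transport `γ_* ⊗ γ_*` (Deligne 1970, I.1: tensor operations on local systems are performed fibrewise). [cite: Deligne1970, I.1] -/
def tensor (V₁ V₂ : LocalSystem R S) : LocalSystem R S where
  obj x := ModuleCat.of R (V₁.obj x ⊗[R] V₂.obj x)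
  map g := ModuleCat.ofHom (TensorProduct.map (V₁.map g).hom (V₂.map g).hom)
  map_id x := by
    ext : 1
    simp only [CategoryTheory.Functor.map_id, ModuleCat.hom_id, TensorProduct.map_id, ModuleCat.hom_ofHom]
  map_comp f g := by
    ext : 1
    simp only [CategoryTheory.Functor.map_comp, ModuleCat.hom_comp, TensorProduct.map_comp, ModuleCat.hom_ofHom]

/-- The value of `V₁ ⊗ V₂` at a point of the fundamental groupoid. [cite: Deligne1970, I.1] -/
@[simp] theorem tensor_obj (V₁ V₂ : LocalSystem R S) (x : FundamentalGroupoid S) :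
    (V₁.tensor V₂).obj x = ModuleCat.of R (V₁.obj x ⊗[R] V₂.obj x) := rfl

/-- The fibre of `V₁ ⊗ V₂` at `s` is `V₁,s ⊗ V₂,s`. [cite: Deligne1970, I.1] -/
theorem tensor_fiber (V₁ V₂ : LocalSystem R S) (s : S) : (V₁.tensor V₂).fiber s = ModuleCat.of R (V₁.fiber s ⊗[R] V₂.fiber s) := rfl

/-- `V₁ ⊗ V₂` on morphisms is the tensor product of `V₁` and `V₂` on morphisms. [cite: Deligne1970, I.1] -/
theorem tensor_map_hom (V₁ V₂ : LocalSystem R S) {x y : FundamentalGroupoid S} (g : x ⟶ y) :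
    ((V₁.tensor V₂).map g).hom = TensorProduct.map (V₁.map g).hom (V₂.map g).hom := rfl

/-- **Transport in `V₁ ⊗ V₂` is the tensor product of the transports.** [cite: Deligne1970, I.1] -/
theorem tensor_transport (V₁ V₂ : LocalSystem R S) {s t : S} (γ : Path.Homotopic.Quotient s t) :
    (V₁.tensor V₂).transport γ = TensorProduct.map (V₁.transport γ) (V₂.transport γ) := rfl

/-- Transport of a pure tensor: `γ · (v₁ ⊗ v₂) = γ·v₁ ⊗ γ·v₂`. [cite: Deligne1970, I.1] -/
theorem tensor_transport_tmul (V₁ V₂ : LocalSystem R S) {s t : S} (γ : Path.Homotopic.Quotient s t) (v₁ : V₁.fiber s) (v₂ : V₂.fiber s) :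
    (V₁.tensor V₂).transport γ (v₁ ⊗ₜ[R] v₂) = V₁.transport γ v₁ ⊗ₜ[R] V₂.transport γ v₂ := rfl

/-- `⊗` commutes with pull-back of local systems. [cite: Deligne1970, I.1] -/
theorem tensor_comap {S' : Type u} [TopologicalSpace S'] (f : C(S', S)) (V₁ V₂ : LocalSystem R S) :
    (V₁.comap f).tensor (V₂.comap f) = (V₁.tensor V₂).comap f := rfl

end LocalSystem

namespace VHSData

variable {S : Type} [TopologicalSpace S] {k₁ k₂ : ℤ} (D₁ : VHSData S k₁) (D₂ : VHSData S k₂)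

/-! ## §2 The comparison `ℚ ⊗ (V₁,ℤ ⊗_ℤ V₂,ℤ) ⥲ V₁ ⊗_ℚ V₂` -/

/-- **The comparison `ℚ ⊗_ℤ (V₁,ℤ,x ⊗_ℤ V₂,ℤ,x) ≅ V₁,x ⊗_ℚ V₂,x`** (component of the natural isomorphism, in `ModuleCat ℚ`): base change
distributes over `⊗` (Mathlib `TensorProduct.AlgebraTensorModule.distribBaseChange`, the oplax structure `δ` of the monoidal functor
`ModuleCat.extendScalars`), followed by `ratIso₁⁻¹ ⊗ ratIso₂⁻¹`. [cite: Schmid1973, §2 (`V_ℚ = V_ℤ ⊗ ℚ`)] [cite: Deligne1970, I.1] -/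
def tensorRatIsoApp (x : FundamentalGroupoid S) :
    ((D₁.VZ.tensor D₂.VZ).baseChange (Int.castRingHom ℚ)).obj x ≅ (D₁.V.tensor D₂.V).obj x :=
  letI : Algebra ℤ ℚ := (Int.castRingHom ℚ).toAlgebra
  (TensorProduct.AlgebraTensorModule.distribBaseChange ℤ ℚ (D₁.VZ.obj x) (D₂.VZ.obj x)).toModuleIso ≪≫
    (TensorProduct.congr (D₁.ratIso.app x).toLinearEquiv.symm (D₂.ratIso.app x).toLinearEquiv.symm).toModuleIso

/-- **`1 ⊗ (m₁ ⊗ m₂) ↦ toRat m₁ ⊗ toRat m₂`.** [cite: Schmid1973, §2 (`V_ℚ = V_ℤ ⊗ ℚ`)] -/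
theorem tensorRatIsoApp_hom_one_tmul (x : FundamentalGroupoid S) (m₁ : D₁.VZ.obj x) (m₂ : D₂.VZ.obj x) :
    (D₁.tensorRatIsoApp D₂ x).hom ((1 : ℚ) ⊗ₜ[ℤ,Int.castRingHom ℚ] (m₁ ⊗ₜ[ℤ] m₂ : (D₁.VZ.tensor D₂.VZ).obj x)) =
      D₁.toRat x.as m₁ ⊗ₜ[ℚ] D₂.toRat x.as m₂ := rfl

/-- **Naturality of the comparison** along `g : x ⟶ y` in `Π₁(S)`: `θ_y ∘ (1 ⊗ (V₁,ℤ g ⊗ V₂,ℤ g)) = (V₁ g ⊗ V₂ g) ∘ θ_x` — on `1 ⊗ (m₁ ⊗ m₂)` both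
give `toRat(g·m₁) ⊗ toRat(g·m₂)` (naturality of `toRat`). [cite: Deligne1970, I.1] [cite: Schmid1973, §2] -/
theorem tensorRatIsoApp_naturality {x y : FundamentalGroupoid S} (g : x ⟶ y) :
    ((D₁.VZ.tensor D₂.VZ).baseChange (Int.castRingHom ℚ)).map g ≫ (D₁.tensorRatIsoApp D₂ y).hom =
      (D₁.tensorRatIsoApp D₂ x).hom ≫ (D₁.V.tensor D₂.V).map g := by
  set α := ((D₁.VZ.tensor D₂.VZ).baseChange (Int.castRingHom ℚ)).map g ≫ (D₁.tensorRatIsoApp D₂ y).hom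
  set β := (D₁.tensorRatIsoApp D₂ x).hom ≫ (D₁.V.tensor D₂.V).map g
  apply ModuleCat.ExtendScalars.hom_ext
  intro m
  -- `m ↦ 1 ⊗ m` as a `ℤ`-linear map into the extension of scalars (for the `zero`/`add` cases)
  let ι : (D₁.VZ.tensor D₂.VZ).obj x →ₗ[ℤ] ((D₁.VZ.tensor D₂.VZ).baseChange (Int.castRingHom ℚ)).obj x :=
    TensorProduct.mk ℤ ((ModuleCat.restrictScalars (Int.castRingHom ℚ)).obj (ModuleCat.of ℚ ℚ)) ((D₁.VZ.tensor D₂.VZ).obj x)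
      ((1 : ℚ) : ((ModuleCat.restrictScalars (Int.castRingHom ℚ)).obj (ModuleCat.of ℚ ℚ)))
  induction m using TensorProduct.induction_on with
  | zero =>
    change α.hom (ι 0) = β.hom (ι 0)
    rw [map_zero, map_zero, map_zero]
  | tmul m₁ m₂ =>
    change D₁.toRat y.as ((D₁.VZ.map g).hom m₁) ⊗ₜ[ℚ] D₂.toRat y.as ((D₂.VZ.map g).hom m₂) =
      (D₁.V.map g).hom (D₁.toRat x.as m₁) ⊗ₜ[ℚ] (D₂.V.map g).hom (D₂.toRat x.as m₂)
    rw [D₁.map_hom_toRat, D₂.map_hom_toRat]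
  | add a b ha hb =>
    -- the induction produces `a + b` in `V₁,ℤ,x ⊗ V₂,ℤ,x` (not in the fibre object), so rewrite through `map_add ι a b` up to defeq
    have key : α.hom (ι a + ι b) = β.hom (ι a + ι b) := by
      rw [map_add, map_add]
      exact congrArg₂ (· + ·) ha hb
    exact (DFunLike.congr_arg α.hom (map_add ι a b)).trans (key.trans (DFunLike.congr_arg β.hom (map_add ι a b)).symm)

/-- **The comparison isomorphism of local systems `(V₁,ℤ ⊗ V₂,ℤ) ⊗ ℚ ≅ V₁ ⊗ V₂`** (natural in the point of `Π₁(S)`). [cite: Deligne1970, I.1] [cite: Schmid1973, §2] -/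
def tensorRatIso : (D₁.VZ.tensor D₂.VZ).baseChange (Int.castRingHom ℚ) ≅ D₁.V.tensor D₂.V :=
  NatIso.ofComponents (fun x => D₁.tensorRatIsoApp D₂ x) fun g => D₁.tensorRatIsoApp_naturality D₂ g

/-! ## §3 The tensor product of two VHS data -/

/-- Flatness of the product form: `(Q₁,t ⊗ Q₂,t)(γx, γy) = (Q₁,s ⊗ Q₂,s)(x, y)` because both transports are isometries (checked on pure
tensors, `Polarization.tensor_form_tmul`). [cite: Schmid1973, §2] [cite: DeligneHodgeII1971, 2.1.15] -/
private theorem tensorForm_map_map [HodgeTensorFacts.{0, 0}] {s t : S} [Module.Finite ℚ (D₁.V.fiber s)] [Module.Finite ℚ (D₂.V.fiber s)]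
    [Module.Finite ℚ (D₁.V.fiber t)] [Module.Finite ℚ (D₂.V.fiber t)] (γ : Path.Homotopic.Quotient s t)
    (x y : D₁.V.fiber s ⊗[ℚ] D₂.V.fiber s) :
    ((D₁.form t).tensor (D₂.form t)).form (TensorProduct.map (D₁.V.transport γ) (D₂.V.transport γ) x)
        (TensorProduct.map (D₁.V.transport γ) (D₂.V.transport γ) y) = ((D₁.form s).tensor (D₂.form s)).form x y := by
  induction x using TensorProduct.induction_on with
  | zero => simp only [map_zero, LinearMap.zero_apply]
  | tmul x₁ x₂ =>
    induction y using TensorProduct.induction_on with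
    | zero => simp only [map_zero]
    | tmul y₁ y₂ =>
      rw [TensorProduct.map_tmul, TensorProduct.map_tmul, HodgeStructure.Polarization.tensor_form_tmul,
        HodgeStructure.Polarization.tensor_form_tmul, D₁.transport_form, D₂.transport_form]
    | add y y' hy hy' => rw [map_add, map_add, map_add, hy, hy']
  | add x x' hx hx' => rw [map_add, map_add, LinearMap.add_apply, map_add, LinearMap.add_apply, hx, hx']

/-- **The tensor product `D₁ ⊗ D₂` of the data of two polarized variations of Hodge structure** of weights `k₁`, `k₂` on `S` (Griffiths 1970 §1 ∕
Schmid 1973 §2: variations are stable under `⊗`): integral and rational local systems `V₁,ℤ ⊗ V₂,ℤ`, `V₁ ⊗ V₂` (§1), comparison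
`V₁ ⊗ V₂ ≅ (V₁,ℤ ⊗ V₂,ℤ) ⊗ ℚ` (§2), on each fibre the tensor Hodge structure of weight `k₁ + k₂` (`HodgeStructure.tensor`, Deligne Hodge II 1.1.12)
polarized by the product form `Q₁ ⊗ Q₂` (`Polarization.tensor`, Hodge II 2.1.15 ∕ Moonen §2.1), flat since both transports are isometries; the
integral fibres `V₁,ℤ,s ⊗ V₂,ℤ,s` are finitely generated free. [cite: Griffiths1970, §1] [cite: Schmid1973, §2] [cite: DeligneHodgeII1971, 1.1.12 and 2.1.15] -/
def tensor : VHSData S (k₁ + k₂) where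
  VZ := D₁.VZ.tensor D₂.VZ
  V := D₁.V.tensor D₂.V
  ratIso := (D₁.tensorRatIso D₂).symm
  hodge s :=
    haveI : HodgeTensorFacts.{0, 0} := hodgeTensorFacts_holds
    (D₁.hodge s).tensor (D₂.hodge s)
  form s :=
    haveI : HodgeTensorFacts.{0, 0} := hodgeTensorFacts_holds
    haveI : Module.Finite ℚ (D₁.V.fiber s) := D₁.finite_fiber s
    haveI : Module.Finite ℚ (D₂.V.fiber s) := D₂.finite_fiber s
    (D₁.form s).tensor (D₂.form s)
  transport_form s t γ x y := by
    haveI : HodgeTensorFacts.{0, 0} := hodgeTensorFacts_holds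
    haveI : Module.Finite ℚ (D₁.V.fiber s) := D₁.finite_fiber s
    haveI : Module.Finite ℚ (D₂.V.fiber s) := D₂.finite_fiber s
    haveI : Module.Finite ℚ (D₁.V.fiber t) := D₁.finite_fiber t
    haveI : Module.Finite ℚ (D₂.V.fiber t) := D₂.finite_fiber t
    exact tensorForm_map_map D₁ D₂ γ x y
  finite_free s := by
    haveI := D₁.finite s
    haveI := D₂.finite s
    haveI := D₁.free s
    haveI := D₂.free s
    -- `Module.Free.tensor` wants `IsScalarTower ℤ ℤ _`, which instance search does not produce for an abstract `ℤ`-module;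
    -- go through bases instead: `V₁,ℤ,s ⊗ V₂,ℤ,s ≃ (ι →₀ ℤ) ⊗ (κ →₀ ℤ) ≃ (ι × κ →₀ ℤ)`.
    exact ⟨Module.Finite.tensorProduct ℤ _ _, Module.Free.of_equiv ((finsuppTensorFinsupp' ℤ _ _).symm ≪≫ₗ
      TensorProduct.congr (Module.Free.chooseBasis ℤ (D₁.VZ.fiber s)).repr.symm (Module.Free.chooseBasis ℤ (D₂.VZ.fiber s)).repr.symm)⟩

/-! ## §4 API -/

/-- The integral local system of `D₁ ⊗ D₂` is `V₁,ℤ ⊗ V₂,ℤ`. [cite: Deligne1970, I.1] -/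
@[simp] theorem tensor_VZ : (D₁.tensor D₂).VZ = D₁.VZ.tensor D₂.VZ := rfl

/-- The rational local system of `D₁ ⊗ D₂` is `V₁ ⊗ V₂`. [cite: Deligne1970, I.1] -/
@[simp] theorem tensor_V : (D₁.tensor D₂).V = D₁.V.tensor D₂.V := rfl

/-- The Hodge structure of `D₁ ⊗ D₂` at `s` is the tensor Hodge structure. [cite: DeligneHodgeII1971, 1.1.12] -/
theorem tensor_hodge [HodgeTensorFacts.{0, 0}] (s : S) : (D₁.tensor D₂).hodge s = (D₁.hodge s).tensor (D₂.hodge s) := rfl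

/-- The polarization form of `D₁ ⊗ D₂` at `s` on pure tensors: `(Q₁ ⊗ Q₂)(x₁ ⊗ x₂, y₁ ⊗ y₂) = Q₁(x₁, y₁) Q₂(x₂, y₂)`.
[cite: DeligneHodgeII1971, 2.1.15] [cite: Moonen2017FamiliesMotives, §2.1 (p. 3)] -/
theorem tensor_form_form_tmul (s : S) (x₁ y₁ : D₁.V.fiber s) (x₂ y₂ : D₂.V.fiber s) :
    ((D₁.tensor D₂).form s).form (x₁ ⊗ₜ[ℚ] x₂) (y₁ ⊗ₜ[ℚ] y₂) = (D₁.form s).form x₁ y₁ * (D₂.form s).form x₂ y₂ := by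
  haveI : HodgeTensorFacts.{0, 0} := hodgeTensorFacts_holds
  haveI : Module.Finite ℚ (D₁.V.fiber s) := D₁.finite_fiber s
  haveI : Module.Finite ℚ (D₂.V.fiber s) := D₂.finite_fiber s
  exact HodgeStructure.Polarization.tensor_form_tmul (D₁.form s) (D₂.form s) x₁ y₁ x₂ y₂

/-- Rational transport of `D₁ ⊗ D₂` is the tensor product of the transports. [cite: Deligne1970, I.1] -/
theorem tensor_V_transport {s t : S} (γ : Path.Homotopic.Quotient s t) :
    (D₁.tensor D₂).V.transport γ = TensorProduct.map (D₁.V.transport γ) (D₂.V.transport γ) := rfl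

/-- Integral transport of `D₁ ⊗ D₂` is the tensor product of the integral transports. [cite: Deligne1970, I.1] -/
theorem tensor_VZ_transport {s t : S} (γ : Path.Homotopic.Quotient s t) :
    (D₁.tensor D₂).VZ.transport γ = TensorProduct.map (D₁.VZ.transport γ) (D₂.VZ.transport γ) := rfl

/-- **`toRat(m₁ ⊗ m₂) = toRat m₁ ⊗ toRat m₂`**: the comparison `V_ℤ → V` of `D₁ ⊗ D₂` on a pure tensor of integral vectors.
[cite: Schmid1973, §2 (`V_ℚ = V_ℤ ⊗ ℚ`)] -/
theorem tensor_toRat_tmul (s : S) (m₁ : D₁.VZ.fiber s) (m₂ : D₂.VZ.fiber s) :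
    (D₁.tensor D₂).toRat s (m₁ ⊗ₜ[ℤ] m₂) = D₁.toRat s m₁ ⊗ₜ[ℚ] D₂.toRat s m₂ := rfl

/-- **Hodge classes multiply**: if the integral vectors `u₁ ∈ V₁,ℤ,s`, `u₂ ∈ V₂,ℤ,s` are Hodge classes of levels `p₁`, `p₂` for `D₁`, `D₂`, then
`u₁ ⊗ u₂` is a Hodge class of level `p₁ + p₂` for `D₁ ⊗ D₂` (`F^{p₁} ⊗ F^{p₂} ⊆ F^{p₁+p₂}`). [cite: DeligneHodgeII1971, 1.1.12] [cite: Griffiths1970, §1] -/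
theorem isHodgeAt_tensor_tmul (s : S) {p₁ p₂ : ℤ} {u₁ : D₁.VZ.fiber s} {u₂ : D₂.VZ.fiber s} (h₁ : D₁.IsHodgeAt s p₁ u₁)
    (h₂ : D₂.IsHodgeAt s p₂ u₂) : (D₁.tensor D₂).IsHodgeAt s (p₁ + p₂) (u₁ ⊗ₜ[ℤ] u₂) := by
  haveI : HodgeTensorFacts.{0, 0} := hodgeTensorFacts_holds
  rw [IsHodgeAt, tensor_toRat_tmul, HodgeStructure.mem_hodgeClasses_iff]
  have h := HodgeStructure.tensorBaseChange_symm_tmul_mem_F (D₁.hodge s) (D₂.hodge s) h₁ h₂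
  have hrw : (HodgeStructure.tensorBaseChange (D₁.V.fiber s) (D₂.V.fiber s)).symm
      (HodgeStructure.ofRat (D₁.toRat s u₁) ⊗ₜ[ℂ] HodgeStructure.ofRat (D₂.toRat s u₂)) =
      HodgeStructure.ofRat (D₁.toRat s u₁ ⊗ₜ[ℚ] D₂.toRat s u₂) := by
    rw [LinearEquiv.symm_apply_eq, HodgeStructure.ofRat_apply, HodgeStructure.ofRat_apply, HodgeStructure.ofRat_apply,
      HodgeStructure.tensorBaseChange_tmul]
  rw [hrw] at h
  exact h

/-- **Determinations in `D₁ ⊗ D₂`**: the determination of `u₁ ⊗ u₂` along `γ` is `γ·u₁ ⊗ γ·u₂`, so it is of level `p₁ + p₂` as soon as `γ·u₁`,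
`γ·u₂` are of levels `p₁`, `p₂`. [cite: DeligneHodgeII1971, 1.1.12] [cite: CattaniDeligneKaplan1995, §1] -/
theorem isHodgeAt_tensor_transport_tmul {s t : S} (γ : Path.Homotopic.Quotient s t) {p₁ p₂ : ℤ} {u₁ : D₁.VZ.fiber s} {u₂ : D₂.VZ.fiber s}
    (h₁ : D₁.IsHodgeAt t p₁ (D₁.VZ.transport γ u₁)) (h₂ : D₂.IsHodgeAt t p₂ (D₂.VZ.transport γ u₂)) :
    (D₁.tensor D₂).IsHodgeAt t (p₁ + p₂) ((D₁.tensor D₂).VZ.transport γ (u₁ ⊗ₜ[ℤ] u₂)) := by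
  exact D₁.isHodgeAt_tensor_tmul D₂ t h₁ h₂

/-- `⊗` commutes with pull-back of VHS data along a continuous map: the fibres, transports, Hodge structures and forms of `(f* D₁) ⊗ (f* D₂)` and
`f* (D₁ ⊗ D₂)` agree (both are read at `f s'`); stated on `toRat`. [cite: Deligne1970, I.1] -/
theorem comap_tensor_toRat {S' : Type} [TopologicalSpace S'] (f : C(S', S)) (s' : S') :
    ((D₁.comap f).tensor (D₂.comap f)).toRat s' = ((D₁.tensor D₂).comap f).toRat s' := rfl

end VHSData

end Literature.AlgebraicGeometry.Motives

end
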